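import Literature.Analysis.Prevalence.Basic

/-!
# Probes: finite-dimensional criteria for shyness and prevalence

The practical way to prove that a set `T` in an infinite-dimensional space `V` is prevalent
(Hunt–Sauer–Yorke [HuntSauerYorke1992, §2, Definition 6 and the discussion before Fact 1]) is to
exhibit a **probe**: a finite-dimensional subspace `P ⊆ V` such that Lebesgue measure on `P` is
transverse to (a Borel set containing) `Tᶜ`, i.e. for every `v : V`, Lebesgue-almost every `p ∈ P`
has `v + p ∈ T`. "A set with a probe is prevalent."

We prove this criterion in the following forms (all for a Borel set; for a general set apply them
to a Borel sub/superset):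

* `isTransverse_map_restrict`, `isShy_of_forall_measure_preimage_vadd_eq_zero` — the underlying
  pushforward principle: if `φ : W → V` is continuous, `ρ` is a measure on `W` giving positive
  finite mass to some compact set, and `ρ (φ ⁻¹' (v +ᵥ S)) = 0` for all `v`, then the image of
  `ρ` (restricted to that compact set) is transverse to `S`, so `S` is shy.
* `isShy_of_forall_addHaar_preimage_eq_zero` — `W` a locally compact group with a Haar measure.
* `isShy_of_forall_volume_sum_smul`, `isPrevalent_of_forall_ae_sum_smul_mem` — the
  **`k`-dimensional probe** spanned by vectors `w₁, …, w_k` (HSY Definition 6, parametrised by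
  `ℝᵏ`): if for every `v`, Lebesgue-a.e. `t ∈ ℝᵏ` has `v + ∑ tᵢ • wᵢ ∈ T`, then `T` is prevalent.
* `isShy_of_forall_volume_smul` — the one-dimensional probe (HSY, §2: "Lebesgue measure on the
  one-dimensional space spanned by `w` is transverse to `S` if for all `v ∈ V` the set of `λ` with
  `v + λ w ∈ S` has Lebesgue measure zero"), and its corollary `isShy_of_countable` — countable
  subsets of a real topological vector space with a non-zero vector are shy (HSY §2).

## Remarks

The parametrised form does not require the `wᵢ` to be linearly independent: the image of Lebesgue
measure under `t ↦ ∑ tᵢ • wᵢ` restricted to a cube is a compactly supported finite measure all of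
whose translates of `S` are null, which is all Definition 1 asks; when the `wᵢ` are independent it
*is* (a) Lebesgue measure on `P = span {wᵢ}`, so this is HSY Definition 6 verbatim.

## References

* B. R. Hunt, T. Sauer, J. A. Yorke, *Prevalence*, Bull. AMS 27 (1992) 217–238, §2 (Definition 6,
  Fact 6). [HuntSauerYorke1992]
-/

open MeasureTheory Set Filter
open scoped Pointwise ENNReal Topology

namespace Literature.Analysis.Prevalence

variable {V : Type*} [AddCommGroup V] [TopologicalSpace V] [MeasurableSpace V]
variable {S T : Set V}

/-! ### Pushforward principle -/

section Pushforward

variable {W : Type*} [TopologicalSpace W] [MeasurableSpace W] [OpensMeasurableSpace W]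
  [BorelSpace V] [MeasurableAdd V]

/-- **Pushforward principle.** If `φ : W → V` is continuous, `C ⊆ W` is compact with
`0 < ρ C < ∞`, `S` is Borel and `ρ (φ ⁻¹' (v +ᵥ S)) = 0` for every `v`, then the image under `φ`
of `ρ` restricted to `C` is transverse to `S` (its compact set is `φ '' C`). This is how HSY use
"Lebesgue measure supported on a finite-dimensional subspace" (§2, after Definition 2). [folklore] -/
theorem isTransverse_map_restrict {φ : W → V} (hφ : Continuous φ) {ρ : Measure W} {C : Set W}
    (hC : IsCompact C) (hpos : 0 < ρ C) (hfin : ρ C < ∞) (hS : MeasurableSet S)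
    (h : ∀ v : V, ρ (φ ⁻¹' (v +ᵥ S)) = 0) : IsTransverse ((ρ.restrict C).map φ) S := by
  have : IsFiniteMeasure (ρ.restrict C) := isFiniteMeasure_restrict.2 hfin.ne
  refine ⟨⟨φ '' C, hC.image hφ, hpos.trans_le ?_, measure_lt_top _ _⟩, fun v => ?_⟩
  · calc ρ C = ρ.restrict C C := by rw [Measure.restrict_apply_self]
      _ ≤ ρ.restrict C (φ ⁻¹' (φ '' C)) := measure_mono (subset_preimage_image φ C)
      _ ≤ (ρ.restrict C).map φ (φ '' C) := Measure.le_map_apply hφ.measurable.aemeasurable _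
  · rw [Measure.map_apply hφ.measurable (hS.const_vadd v)]
    exact (Measure.absolutelyContinuous_of_le Measure.restrict_le_self) (h v)

/-- **Pushforward criterion for shyness**: under the hypotheses of `isTransverse_map_restrict`,
the Borel set `S` is shy. [folklore] -/
theorem isShy_of_forall_measure_preimage_vadd_eq_zero {φ : W → V} (hφ : Continuous φ)
    {ρ : Measure W} {C : Set W} (hC : IsCompact C) (hpos : 0 < ρ C) (hfin : ρ C < ∞)
    (hS : MeasurableSet S) (h : ∀ v : V, ρ (φ ⁻¹' (v +ᵥ S)) = 0) : IsShy S :=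
  (isTransverse_map_restrict hφ hC hpos hfin hS h).isShy hS

end Pushforward

/-! ### Probes modelled on a locally compact group with Haar measure -/

section Haar

variable {W : Type*} [TopologicalSpace W] [MeasurableSpace W] [BorelSpace W] [AddGroup W]
  [LocallyCompactSpace W] [BorelSpace V] [MeasurableAdd V]

/-- **Haar-measure probe.** Let `W` be a locally compact group with (left) Haar measure `ρ` and
`φ : W → V` continuous (e.g. the inclusion of, or a linear parametrisation of, a
finite-dimensional subspace). If `S` is Borel and `ρ (φ ⁻¹' (v +ᵥ S)) = 0` for every `v : V`, then
`S` is shy. [cite: HuntSauerYorke1992, §2 Definition 6] -/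
theorem isShy_of_forall_addHaar_preimage_eq_zero (ρ : Measure W) [ρ.IsAddHaarMeasure]
    {φ : W → V} (hφ : Continuous φ) (hS : MeasurableSet S)
    (h : ∀ v : V, ρ (φ ⁻¹' (v +ᵥ S)) = 0) : IsShy S := by
  obtain ⟨C, hC, hC0⟩ := exists_compact_mem_nhds (0 : W)
  exact isShy_of_forall_measure_preimage_vadd_eq_zero hφ hC
    (Measure.measure_pos_of_mem_nhds ρ hC0) hC.measure_lt_top hS h

/-- Prevalent form of the Haar-measure probe: if `T` is Borel and for every `v : V`,
`ρ`-almost every `w : W` has `v + φ w ∈ T`, then `T` is prevalent.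
[cite: HuntSauerYorke1992, §2 Definition 6] -/
theorem isPrevalent_of_forall_ae_add_mem (ρ : Measure W) [ρ.IsAddHaarMeasure]
    {φ : W → V} (hφ : Continuous φ) (hT : MeasurableSet T)
    (h : ∀ v : V, ∀ᵐ w ∂ρ, v + φ w ∈ T) : IsPrevalent T := by
  refine isShy_of_forall_addHaar_preimage_eq_zero ρ hφ hT.compl fun v => ?_
  have := h (-v)
  rw [ae_iff] at this
  convert this using 2
  ext w
  simp [mem_vadd_set_iff_neg_vadd_mem, vadd_eq_add]

end Haar

/-! ### `k`-dimensional probes parametrised by `ℝᵏ` (HSY Definition 6) -/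

section Linear

variable [Module ℝ V] [ContinuousSMul ℝ V] [BorelSpace V] [MeasurableAdd V]

/-- **`k`-dimensional probe, shy form.** If `S` is Borel and for every `v : V` the set of
parameters `t ∈ ℝᵏ` with `v + ∑ i, t i • w i ∈ S` is Lebesgue-null, then `S` is shy: Lebesgue
measure on the subspace spanned by `w₁, …, w_k` (pushed forward from `ℝᵏ`) is transverse to `S`.
[cite: HuntSauerYorke1992, §2 Definition 6] -/
theorem isShy_of_forall_volume_sum_smul [ContinuousAdd V] {k : ℕ} (w : Fin k → V)
    (hS : MeasurableSet S)
    (h : ∀ v : V, volume {t : Fin k → ℝ | v + ∑ i, t i • w i ∈ S} = 0) : IsShy S := by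
  have hφ : Continuous fun t : Fin k → ℝ => ∑ i, t i • w i :=
    continuous_finsetSum _ fun i _ => (continuous_apply i).smul continuous_const
  refine isShy_of_forall_addHaar_preimage_eq_zero (volume : Measure (Fin k → ℝ)) hφ hS fun v => ?_
  convert h (-v) using 2
  ext t
  simp [mem_vadd_set_iff_neg_vadd_mem, vadd_eq_add]

/-- **`k`-dimensional probe, prevalent form** ("a set with a probe is prevalent"): if `T` is
Borel and for every `v : V`, Lebesgue-a.e. `t ∈ ℝᵏ` has `v + ∑ i, t i • w i ∈ T`, then `T` is
prevalent. [cite: HuntSauerYorke1992, §2 Definition 6] -/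
theorem isPrevalent_of_forall_ae_sum_smul_mem [ContinuousAdd V] {k : ℕ} (w : Fin k → V)
    (hT : MeasurableSet T)
    (h : ∀ v : V, ∀ᵐ t : Fin k → ℝ, v + ∑ i, t i • w i ∈ T) : IsPrevalent T :=
  isPrevalent_of_forall_ae_add_mem (volume : Measure (Fin k → ℝ))
    (continuous_finsetSum _ fun i _ => (continuous_apply i).smul continuous_const) hT h

/-- **One-dimensional probe** (HSY §2): if `S` is Borel and for every `v : V` the set of `t : ℝ`
with `v + t • w ∈ S` is Lebesgue-null, then `S` is shy.
[cite: HuntSauerYorke1992, §2 (discussion after Definition 2)] -/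
theorem isShy_of_forall_volume_smul (w : V) (hS : MeasurableSet S)
    (h : ∀ v : V, volume {t : ℝ | v + t • w ∈ S} = 0) : IsShy S := by
  have hφ : Continuous fun t : ℝ => t • w := continuous_id.smul continuous_const
  refine isShy_of_forall_addHaar_preimage_eq_zero (volume : Measure ℝ) hφ hS fun v => ?_
  convert h (-v) using 2
  ext t
  simp [mem_vadd_set_iff_neg_vadd_mem, vadd_eq_add]

/-- One-dimensional probe, prevalent form: if `T` is Borel and for every `v`, Lebesgue-a.e.
`t : ℝ` has `v + t • w ∈ T`, then `T` is prevalent.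
[cite: HuntSauerYorke1992, §2 (discussion after Definition 2)] -/
theorem isPrevalent_of_forall_ae_smul_mem (w : V) (hT : MeasurableSet T)
    (h : ∀ v : V, ∀ᵐ t : ℝ, v + t • w ∈ T) : IsPrevalent T :=
  have hφ : Continuous fun t : ℝ => t • w := continuous_id.smul continuous_const
  isPrevalent_of_forall_ae_add_mem (volume : Measure ℝ) hφ hT h

/-- **Countable sets are shy** (HSY §2: "it immediately follows that every countable set in `V`
is shy"), in a real topological vector space containing a non-zero vector: the line through
`w ≠ 0` meets each translate of a countable set in countably many parameters.
[cite: HuntSauerYorke1992, §2 (discussion after Definition 2)] -/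
theorem isShy_of_countable [T1Space V] {w : V} (hw : w ≠ 0) (hS : S.Countable) : IsShy S := by
  refine isShy_of_forall_volume_smul w hS.measurableSet fun v => Countable.measure_zero ?_ _
  have hinj : Function.Injective fun t : ℝ => v + t • w := fun a b hab => by
    exact smul_left_injective ℝ hw (add_left_cancel hab)
  exact (hS.preimage_of_injOn hinj.injOn).mono fun t ht => ht

/-- In particular singletons (and finite sets) are shy in a real topological vector space with a
non-zero vector. [cite: HuntSauerYorke1992, §2 (discussion after Definition 2)] -/
theorem isShy_singleton [T1Space V] {w : V} (hw : w ≠ 0) (x : V) : IsShy ({x} : Set V) :=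
  isShy_of_countable hw (countable_singleton x)

end Linear

end Literature.Analysis.Prevalence
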